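import Summits.QuantumFields.QCD.Theses.SpectralDefectExtinction
import Summits.QuantumFields.QCD.Theorems.ExtinctionBuildsQCD.Negative.ExtinctIntegrable

/-!
# Stub `stub_twoLineAssembly` (S2e) of line `corner-decorrelation-deep-hole` — auxiliary file 2:
# measurability of the box events, the union bound in phase-quenched mean, elementary asymptotics
(crux `Summit.QuantumFields.QCD.Theses.SpectralDefectExtinction.WindowExtinction`, item stmt-QuantumFields-18063)

* `cornerAsm_measurable_boxEvent` — the indicator of the dense-resonance box event
  `N ≤ 16 · #{v ∈ B : ρ(U_{P₀₁(proj v)}) has a characteristic root within ε of e^{iφ₀}}` is measurable in the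
  gauge field (landed `countMeas_measurable_countP` for the closed disc, finite Boolean combination);
* `cornerAsm_ratio_le` — abstract union bound: if `0 ≤ F ≤ A + B Σ_{t ∈ T} e_t` pointwise and every
  `e_t` has `w`-weighted mean `≤ δ`, then the `w`-ratio of `F` is `≤ A + B · #T · δ`;
* `cornerAsm_asymptotics` — the elementary real analysis `16ⁿ · poly(β) · e^{−cℓ⁴} ≤ M (4 − c₁/β)^{2n}` for
  `1 ≤ β`, `n ≤ β³`, `ℓ = ⌊√(β/(1024c₁))⌋`, once `2²⁵ c₁³ ≤ c` and `c₁ ≤ 2⁻²⁵`.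
-/

noncomputable section

namespace Summit.QuantumFields.QCD.Cruxes.WindowExtinction.CornerDecorrelationDeepHole

open scoped BigOperators Topology Classical Matrix
open Filter MeasureTheory
open Literature.MathematicalPhysics.QuantumLattice Literature.MathematicalPhysics.QuantumFieldTheory
  Literature.Probability.LatticeModels
open Summit.QuantumFields.QCD.Cruxes.TipPricing.HermitianFlowCoarea (countMeas_measurable_countP)

/-! ## Measurability of the box events -/

/-- **The dense-resonance box event is measurable in the gauge field**: for a finite set `B` of lattice
points, a threshold `N`, a phase `φ₀` and a width `ε`, the indicator of
`N ≤ 16 · #{v ∈ B : charpoly ρ(U_{P₀₁(proj v)}) has a root w with |w − e^{iφ₀}| ≤ ε}` is measurable. -/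
theorem cornerAsm_measurable_boxEvent (L : ℕ) [NeZero L] (N : ℕ) (B : Finset (Fin 4 → ℤ)) (φ₀ ε : ℝ) :
    Measurable fun U : GaugeConfig 4 L SU3 =>
      (if N ≤ 16 * (B.filter (fun v => 1 ≤ Multiset.countP
          (fun w : ℂ => ‖w - Complex.exp (↑φ₀ * Complex.I)‖ ≤ ε)
          (fundamentalRep (Fin 3) (plaquetteHolonomy U (Torus.proj L v) 0 1)).charpoly.roots)).card
        then (1 : ℝ) else 0) := by
  have hcnt : ∀ v : Fin 4 → ℤ, Measurable fun U : GaugeConfig 4 L SU3 =>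
      Multiset.countP (fun w : ℂ => ‖w - Complex.exp (↑φ₀ * Complex.I)‖ ≤ ε)
        (fundamentalRep (Fin 3) (plaquetteHolonomy U (Torus.proj L v) 0 1)).charpoly.roots := by
    intro v
    have hA : Continuous fun U : GaugeConfig 4 L SU3 =>
        fundamentalRep (Fin 3) (plaquetteHolonomy U (Torus.proj L v) 0 1) :=
      (continuous_fundamentalRep (Fin 3)).comp (by unfold plaquetteHolonomy; fun_prop)
    exact countMeas_measurable_countP hA _ (fun _ => {w : ℂ | ‖w - Complex.exp (↑φ₀ * Complex.I)‖ ≤ ε})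
      (fun _ => isClosed_le (continuous_id.sub continuous_const).norm continuous_const)
      (fun _ _ _ => le_rfl) (fun z => ⟨fun h => ⟨0, h⟩, fun ⟨_, h⟩ => h⟩)
  have hcard : Measurable fun U : GaugeConfig 4 L SU3 => (B.filter (fun v => 1 ≤ Multiset.countP
      (fun w : ℂ => ‖w - Complex.exp (↑φ₀ * Complex.I)‖ ≤ ε)
      (fundamentalRep (Fin 3) (plaquetteHolonomy U (Torus.proj L v) 0 1)).charpoly.roots)).card := by
    simp only [Finset.card_filter]
    refine Finset.measurable_sum _ fun v _ => ?_
    exact Measurable.ite ((hcnt v) (MeasurableSet.of_discrete (s := {j : ℕ | 1 ≤ j})))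
      measurable_const measurable_const
  exact Measurable.ite (hcard (MeasurableSet.of_discrete (s := {j : ℕ | N ≤ 16 * j})))
    measurable_const measurable_const

/-! ## The union bound in phase-quenched mean -/

/-- **Union bound in phase-quenched mean.**  On a measure space with a weight `w ≥ 0`: if
`0 ≤ F ≤ A + B · Σ_{t ∈ T} e_t` pointwise (`A, B ≥ 0`), `w` and every `e_t · w` are integrable, and
`∫ e_t w ≤ δ ∫ w` for every `t ∈ T` (`δ ≥ 0`), then `(∫ F w)/(∫ w) ≤ A + B · #T · δ` (the case `∫ w = 0`
being the junk value `x/0 = 0`). -/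
theorem cornerAsm_ratio_le {X : Type*} [MeasurableSpace X] (μ : Measure X) {ι : Type*} (T : Finset ι)
    {F w : X → ℝ} {e : ι → X → ℝ} {A B δ : ℝ}
    (hw : ∀ x, 0 ≤ w x) (hF0 : ∀ x, 0 ≤ F x) (hA : 0 ≤ A) (hB : 0 ≤ B) (hδ : 0 ≤ δ)
    (hF : ∀ x, F x ≤ A + B * ∑ t ∈ T, e t x)
    (hwi : Integrable w μ) (hei : ∀ t ∈ T, Integrable (fun x => e t x * w x) μ)
    (he : ∀ t ∈ T, ∫ x, e t x * w x ∂μ ≤ δ * ∫ x, w x ∂μ) :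
    (∫ x, F x * w x ∂μ) / (∫ x, w x ∂μ) ≤ A + B * (T.card * δ) := by
  have hZ0 : 0 ≤ ∫ x, w x ∂μ := integral_nonneg hw
  have hsplit : ∀ x, (A + B * ∑ t ∈ T, e t x) * w x = A * w x + B * ∑ t ∈ T, e t x * w x := fun x => by
    rw [add_mul, mul_assoc, Finset.sum_mul]
  have hgi : Integrable (fun x => (A + B * ∑ t ∈ T, e t x) * w x) μ := by
    simp_rw [hsplit]
    exact (hwi.const_mul A).add ((integrable_finsetSum T hei).const_mul B)
  have hint : ∫ x, F x * w x ∂μ ≤ (A + B * (T.card * δ)) * ∫ x, w x ∂μ :=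
    calc ∫ x, F x * w x ∂μ ≤ ∫ x, (A + B * ∑ t ∈ T, e t x) * w x ∂μ :=
          integral_mono_of_nonneg (Eventually.of_forall fun x => mul_nonneg (hF0 x) (hw x)) hgi
            (Eventually.of_forall fun x => mul_le_mul_of_nonneg_right (hF x) (hw x))
      _ = A * ∫ x, w x ∂μ + B * ∑ t ∈ T, ∫ x, e t x * w x ∂μ := by
          simp_rw [hsplit]
          rw [integral_add (hwi.const_mul A) ((integrable_finsetSum T hei).const_mul B), integral_const_mul,
            integral_const_mul, integral_finsetSum T hei]
      _ ≤ A * ∫ x, w x ∂μ + B * ∑ t ∈ T, δ * ∫ x, w x ∂μ := by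
          gcongr with t ht
          exact he t ht
      _ = (A + B * (T.card * δ)) * ∫ x, w x ∂μ := by
          rw [Finset.sum_const, nsmul_eq_mul]; ring
  rcases hZ0.eq_or_lt with hZ | hZ
  · rw [← hZ, div_zero]; positivity
  · rwa [div_le_iff₀ hZ]

/-! ## Elementary asymptotics -/

/-- **Elementary asymptotics of the assembly.**  Let `0 < c₁ ≤ 2⁻²⁵` with `2²⁵ c₁³ ≤ c`.  There is
`M ≥ 0` such that for every `β ≥ 1`, every `n ≤ β³`, `ℓ = ⌊√(β/(1024 c₁))⌋` and every grid range
`K_f ≤ π/√(512θ) + 1` (`θ = c₁/(4β)`):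
`16ⁿ · (2K_f + 1)(2n + 2ℓ + 2)⁴ ℓ⁴ · e^{−cℓ⁴} ≤ M (4 − c₁/β)^{2n}`.
Indeed `(4 − c₁/β)^{2n} = 16ⁿ(1 − θ)^{2n} ≥ 16ⁿ e^{−4nθ} ≥ 16ⁿ e^{−c₁β²}` (`e^{−2θ} ≤ 1 − θ` for
`θ ≤ 1/2`), `cℓ⁴ ≥ cβ²/(2²⁴c₁²) ≥ 2c₁β²` (`ℓ ≥ ½√(β/(1024c₁))`), the prefactor is `≤ 14256 β¹⁷/c₁⁹`, and
`β¹⁷ e^{−c₁β²} ≤ β¹⁸ e^{−c₁β²} ≤ 9!/c₁⁹`. -/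
theorem cornerAsm_asymptotics {c₁ c : ℝ} (hc₁ : 0 < c₁) (hc₁1 : c₁ ≤ 1 / 2 ^ 25) (hc₁c : 2 ^ 25 * c₁ ^ 3 ≤ c) :
    ∃ M : ℝ, 0 ≤ M ∧ ∀ β : ℝ, 1 ≤ β → ∀ n : ℕ, (n : ℝ) ≤ β ^ 3 → ∀ ℓ Kf : ℕ,
      (ℓ : ℝ) ≤ Real.sqrt (β / (1024 * c₁)) → Real.sqrt (β / (1024 * c₁)) < ℓ + 1 →
      (Kf : ℝ) ≤ Real.pi / Real.sqrt (512 * (c₁ / (4 * β))) + 1 →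
      16 ^ n * ((2 * Kf + 1) * (2 * n + 2 * ℓ + 2) ^ 4 * (ℓ : ℝ) ^ 4) * Real.exp (-(c * (ℓ : ℝ) ^ 4)) ≤
        M * (4 - c₁ / β) ^ (2 * n) := by
  set s : ℝ := 1 / c₁ with hs
  have hc₁le1 : c₁ ≤ 1 := hc₁1.trans (by norm_num)
  have hs1 : 1 ≤ s := by rw [hs, le_div_iff₀ hc₁]; linarith
  have hc0 : 0 ≤ c := le_trans (by positivity) hc₁c
  refine ⟨14256 * s ^ 9 * ((9).factorial / c₁ ^ 9), by positivity, ?_⟩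
  intro β hβ n hn ℓ Kf hℓr hrℓ hKf
  have hβ0 : 0 < β := by linarith
  -- `θ` and the rate `4 − c₁/β = 4(1 − θ)`
  set θ : ℝ := c₁ / (4 * β) with hθ
  have hθ0 : 0 ≤ θ := by positivity
  have hθhalf : θ ≤ 1 / 2 := by
    rw [hθ, div_le_iff₀ (by positivity)]
    nlinarith
  have hrate : (4 - c₁ / β) ^ (2 * n) = 16 ^ n * (1 - θ) ^ (2 * n) := by
    have e : 4 - c₁ / β = 4 * (1 - θ) := by
      rw [hθ]
      field_simp
    rw [e, mul_pow, pow_mul]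
    norm_num
  -- `(1 − θ)^{2n} ≥ e^{−c₁β²}`
  have hexpθ : Real.exp (-2 * θ) ≤ 1 - θ := by
    have h1 : 1 + 2 * θ ≤ Real.exp (2 * θ) := by linarith [Real.add_one_le_exp (2 * θ)]
    have h2 : Real.exp (-2 * θ) * Real.exp (2 * θ) = 1 := by
      rw [← Real.exp_add, show -2 * θ + 2 * θ = 0 by ring, Real.exp_zero]
    have h3 : 0 < Real.exp (-2 * θ) := Real.exp_pos _
    have h4 : Real.exp (-2 * θ) * (1 + 2 * θ) ≤ (1 - θ) * (1 + 2 * θ) := by nlinarith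
    exact le_of_mul_le_mul_right h4 (by linarith)
  have hlow : Real.exp (-(c₁ * β ^ 2)) ≤ (1 - θ) ^ (2 * n) := by
    calc Real.exp (-(c₁ * β ^ 2)) ≤ Real.exp ((2 * n : ℕ) * (-2 * θ)) := by
          rw [Real.exp_le_exp]
          have h1 : (n : ℝ) * θ ≤ β ^ 3 * θ := mul_le_mul_of_nonneg_right hn hθ0
          have e1 : β ^ 3 * θ = c₁ * β ^ 2 / 4 := by
            rw [hθ]
            field_simp
          push_cast
          nlinarith
      _ = Real.exp (-2 * θ) ^ (2 * n) := Real.exp_nat_mul _ _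
      _ ≤ (1 - θ) ^ (2 * n) := pow_le_pow_left₀ (Real.exp_pos _).le hexpθ _
  -- upper bounds on `K_f`, `ℓ`, `n` in terms of `β s`
  have hβs : 1 ≤ β * s := one_le_mul_of_one_le_of_one_le hβ hs1
  have hKf' : (Kf : ℝ) ≤ 5 * (β * s) := by
    have hsq : c₁ / β ≤ Real.sqrt (512 * (c₁ / (4 * β))) := by
      refine Real.le_sqrt_of_sq_le ?_
      rw [div_pow, show (512 : ℝ) * (c₁ / (4 * β)) = 128 * c₁ / β by field_simp; ring,
        div_le_div_iff₀ (by positivity) hβ0]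
      have h5 : c₁ ^ 2 ≤ c₁ := by nlinarith
      have h6 : c₁ ^ 2 * β ≤ c₁ * β := mul_le_mul_of_nonneg_right h5 hβ0.le
      have h7 : c₁ * β ≤ c₁ * β ^ 2 := mul_le_mul_of_nonneg_left (by nlinarith) hc₁.le
      nlinarith [mul_nonneg hc₁.le (sq_nonneg β)]
    have h1 : Real.pi / Real.sqrt (512 * (c₁ / (4 * β))) ≤ Real.pi / (c₁ / β) :=
      div_le_div_of_nonneg_left Real.pi_pos.le (by positivity) hsq
    have h2 : Real.pi / (c₁ / β) = Real.pi * (β * s) := by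
      rw [hs]
      field_simp
    have h3 : Real.pi * (β * s) ≤ 4 * (β * s) := mul_le_mul_of_nonneg_right Real.pi_le_four (by positivity)
    linarith
  have hℓ' : (ℓ : ℝ) ≤ β * s := by
    refine hℓr.trans ((Real.sqrt_le_left (by positivity)).2 ?_)
    rw [div_le_iff₀ (by positivity), hs]
    field_simp
    nlinarith
  have hβ3 : β ≤ β ^ 3 := le_self_pow₀ hβ (by norm_num)
  have hβ31 : 1 ≤ β ^ 3 := one_le_pow₀ hβ
  -- the prefactor is `≤ 14256 s⁹ β¹⁷`
  have hNI : (2 * Kf + 1) * (2 * n + 2 * ℓ + 2) ^ 4 * (ℓ : ℝ) ^ 4 ≤ 14256 * s ^ 9 * β ^ 17 := by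
    have h1 : (2 * Kf + 1 : ℝ) ≤ 11 * (β * s) := by linarith
    have h2 : (2 * n + 2 * ℓ + 2 : ℝ) ≤ 6 * (β ^ 3 * s) := by
      have : β * s ≤ β ^ 3 * s := mul_le_mul_of_nonneg_right hβ3 (by positivity)
      have : (1 : ℝ) ≤ β ^ 3 * s := one_le_mul_of_one_le_of_one_le hβ31 hs1
      have : β ^ 3 ≤ β ^ 3 * s := le_mul_of_one_le_right (by positivity) hs1
      linarith
    have h3 : (ℓ : ℝ) ^ 4 ≤ (β * s) ^ 4 := pow_le_pow_left₀ (Nat.cast_nonneg _) hℓ' 4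
    have h4 : (2 * n + 2 * ℓ + 2 : ℝ) ^ 4 ≤ (6 * (β ^ 3 * s)) ^ 4 := pow_le_pow_left₀ (by positivity) h2 4
    calc (2 * Kf + 1) * (2 * n + 2 * ℓ + 2) ^ 4 * (ℓ : ℝ) ^ 4
        ≤ (11 * (β * s)) * (6 * (β ^ 3 * s)) ^ 4 * (β * s) ^ 4 :=
          mul_le_mul (mul_le_mul h1 h4 (by positivity) (by positivity)) h3 (by positivity) (by positivity)
      _ = 14256 * s ^ 9 * β ^ 17 := by ring
  -- lower bound on `ℓ`: `cℓ⁴ ≥ 2c₁β²`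
  have hr2 : (2 : ℝ) ≤ Real.sqrt (β / (1024 * c₁)) := by
    refine Real.le_sqrt_of_sq_le ?_
    rw [le_div_iff₀ (by positivity)]
    nlinarith
  have hℓ4 : β ^ 2 * s ^ 2 / 2 ^ 24 ≤ (ℓ : ℝ) ^ 4 := by
    have hℓlow : Real.sqrt (β / (1024 * c₁)) / 2 ≤ ℓ := by linarith
    have h1 : (Real.sqrt (β / (1024 * c₁)) / 2) ^ 4 ≤ (ℓ : ℝ) ^ 4 :=
      pow_le_pow_left₀ (by positivity) hℓlow 4
    have hsq : Real.sqrt (β / (1024 * c₁)) ^ 2 = β / (1024 * c₁) := Real.sq_sqrt (by positivity)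
    have h2 : (Real.sqrt (β / (1024 * c₁)) / 2) ^ 4 = β ^ 2 * s ^ 2 / 2 ^ 24 := by
      rw [div_pow, show (4 : ℕ) = 2 * 2 from rfl, pow_mul, hsq, hs]
      field_simp
      norm_num
    linarith
  have hdecay : Real.exp (-(c * (ℓ : ℝ) ^ 4)) ≤ Real.exp (-(2 * c₁ * β ^ 2)) := by
    rw [Real.exp_le_exp]
    have h1 : c * (β ^ 2 * s ^ 2 / 2 ^ 24) ≤ c * (ℓ : ℝ) ^ 4 := mul_le_mul_of_nonneg_left hℓ4 hc0
    have h3 : 2 ^ 25 * c₁ ^ 3 * (β ^ 2 * s ^ 2 / 2 ^ 24) ≤ c * (β ^ 2 * s ^ 2 / 2 ^ 24) :=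
      mul_le_mul_of_nonneg_right hc₁c (by positivity)
    have h4 : 2 ^ 25 * c₁ ^ 3 * (β ^ 2 * s ^ 2 / 2 ^ 24) = 2 * c₁ * β ^ 2 := by
      rw [hs]
      field_simp
    linarith
  -- polynomial × Gaussian: `β¹⁷ e^{−c₁β²} ≤ 9!/c₁⁹`
  have hpoly : β ^ 17 * Real.exp (-(c₁ * β ^ 2)) ≤ (9).factorial / c₁ ^ 9 := by
    have h1 := Real.pow_div_factorial_le_exp (c₁ * β ^ 2) (by positivity) 9
    rw [div_le_iff₀ (by positivity)] at h1
    have h2 : β ^ 17 * c₁ ^ 9 ≤ Real.exp (c₁ * β ^ 2) * (9).factorial :=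
      calc β ^ 17 * c₁ ^ 9 ≤ β ^ 18 * c₁ ^ 9 :=
            mul_le_mul_of_nonneg_right (pow_le_pow_right₀ hβ (by norm_num)) (by positivity)
        _ = (c₁ * β ^ 2) ^ 9 := by ring
        _ ≤ Real.exp (c₁ * β ^ 2) * (9).factorial := h1
    have hE : 0 < Real.exp (c₁ * β ^ 2) := Real.exp_pos _
    rw [Real.exp_neg, le_div_iff₀ (by positivity)]
    have key : β ^ 17 * (Real.exp (c₁ * β ^ 2))⁻¹ * c₁ ^ 9 ≤ (9).factorial :=
      calc β ^ 17 * (Real.exp (c₁ * β ^ 2))⁻¹ * c₁ ^ 9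
          = β ^ 17 * c₁ ^ 9 * (Real.exp (c₁ * β ^ 2))⁻¹ := by ring
        _ ≤ Real.exp (c₁ * β ^ 2) * (9).factorial * (Real.exp (c₁ * β ^ 2))⁻¹ :=
            mul_le_mul_of_nonneg_right h2 (by positivity)
        _ = (9).factorial := by
            field_simp
    exact key
  -- assembly
  have hNI0 : 0 ≤ (2 * Kf + 1) * (2 * n + 2 * ℓ + 2) ^ 4 * (ℓ : ℝ) ^ 4 := by positivity
  have key : 16 ^ n * ((2 * Kf + 1) * (2 * n + 2 * ℓ + 2) ^ 4 * (ℓ : ℝ) ^ 4) * Real.exp (-(c * (ℓ : ℝ) ^ 4)) ≤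
      14256 * s ^ 9 * ((9).factorial / c₁ ^ 9) * (4 - c₁ / β) ^ (2 * n) :=
   calc 16 ^ n * ((2 * Kf + 1) * (2 * n + 2 * ℓ + 2) ^ 4 * (ℓ : ℝ) ^ 4) * Real.exp (-(c * (ℓ : ℝ) ^ 4))
      ≤ 16 ^ n * (14256 * s ^ 9 * β ^ 17) * Real.exp (-(2 * c₁ * β ^ 2)) :=
        mul_le_mul (mul_le_mul_of_nonneg_left hNI (by positivity)) hdecay (Real.exp_pos _).le
          (by positivity)
    _ = 14256 * s ^ 9 * (β ^ 17 * Real.exp (-(c₁ * β ^ 2))) * (16 ^ n * Real.exp (-(c₁ * β ^ 2))) := by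
        rw [show -(2 * c₁ * β ^ 2) = -(c₁ * β ^ 2) + -(c₁ * β ^ 2) by ring, Real.exp_add]
        ring
    _ ≤ 14256 * s ^ 9 * ((9).factorial / c₁ ^ 9) * (16 ^ n * (1 - θ) ^ (2 * n)) :=
        mul_le_mul (mul_le_mul_of_nonneg_left hpoly (by positivity))
          (mul_le_mul_of_nonneg_left hlow (by positivity)) (by positivity) (by positivity)
    _ = 14256 * s ^ 9 * ((9).factorial / c₁ ^ 9) * (4 - c₁ / β) ^ (2 * n) := by rw [hrate]
  exact key

end Summit.QuantumFields.QCD.Cruxes.WindowExtinction.CornerDecorrelationDeepHole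

end
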